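import Mathlib.Analysis.SpecialFunctions.Pow.Real
import Mathlib.Analysis.SpecialFunctions.Log.Basic
import Mathlib.Data.Nat.Choose.Bounds
import Literature.Computability.Complexity.CliqueApproximators
import Literature.Computability.Complexity.CircuitSizeProofs
import HarnessLib

/-!
# The monotone circuit complexity of CLIQUE: proof of `razborov_alon_boppana` (pnp.S22)

Discharges (D-0014) two named facts of `CircuitLowerBounds.lean`:

* `exists_monotone_computes_cliqueFn_holds` — for `2 ≤ s ≤ m` the clique function
  `CLIQUE(m, s)` is computed by a circuit over `monotoneBasis = {∧₂, ∨₂}` (the OR over all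
  `s`-subsets of the AND of their edges), so `circuitSizeOver monotoneBasis (cliqueFn m s)` is
  attained (review F13c);
* `razborov_alon_boppana_holds : razborov_alon_boppana` — **Razborov's theorem in the
  Alon–Boppana form**: there is `C > 0` (we take `C = 1/50`) such that for all large `m` every
  monotone circuit computing `CLIQUE(m, ⌊¼ ln m⌋)` has at least `m ^ (C log m)` gates
  (Razborov 1985; Alon–Boppana 1987, §1, the display after (1.1): `L⁺ = m^{Ω(log m)}` for
  `s = ⌊¼ ln m⌋`, and Thm. 3.16: `≥ m^s / (8 s² eˢ log m)ˢ` AND gates for `3 ≤ s ≤ ¼ log m`).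

## Proof outline (Alon–Boppana 1987, §2–§3, with crude constants)

With `L = log m`, `s = ⌊L/4⌋`, `l = s - 1`, `(s-1)`-colourings and `r = ⌈e^{L/3}⌉ = ⌈m^{1/3}⌉`
(our choice, easier to estimate than the paper's `r = ⌈4 s eˢ log₂ m⌉` and only affecting the
constant `C`; any `m^α`, `¼ < α < ½`, would do), Razborov's approximation along the circuit in
the lattice `K(m, r, l)` of closed families (`CliqueApproximators.lean`, `razborov_dichotomy`)
leaves two cases for a monotone circuit of size `t` computing `CLIQUE(m, s)`:

* the approximator of the output contains `∅` (accepts everything): then all `(s-1)^m`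
  colourings are wrongly accepted, each OR gate accepting at most
  `|𝒱(l)| (1 - l!/lˡ)^r (s-1)^m` of them (Lemmas 3.6, 3.7), whence
  `t ≥ e^{r e^{-l}} / (m+1)^l ≥ exp(e^{L/12} - (L+1)L/4)` (`caseA_bound`);
* otherwise every `s`-clique is lost at an AND gate (at most `(r-1)^{2l}` per gate,
  Lemma 3.13 via Cor. 3.3) or contains one of the at most `(r-1)^k` minimal members of
  cardinality `k` of the approximator (Cor. 3.3), whence
  `C(m,s) ≤ t (r-1)^{2l} + Σ_{2≤k≤l} (r-1)^k C(m-k, s-k)`, the sum is at most `½ C(m,s)`, and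
  `t ≥ C(m,s) / (2 (r-1)^{2l}) ≥ ½ e^{sL/4}` (`caseB_bound`).

Both are `≥ exp(L²/50) = m^{log m / 50}` once `L ≥ 1200`. The elementary estimates use only
`1 + y ≤ eʸ`, `yⁿ/n! ≤ eʸ`, `l!/lˡ ≥ e^{-l}`, `1 - y ≤ e^{-y}`, `C(m,s) ≥ (m+1-s)ˢ/s!` and
`C(m-k, s-k) · m(m-1)⋯(m-k+1) = C(m,s) · s(s-1)⋯(s-k+1)`.

## References

* A. A. Razborov, *Lower bounds on the monotone complexity of some Boolean functions*, Dokl.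
  Akad. Nauk SSSR 281 (1985) 798–801 [Razborov1985].
* N. Alon, R. B. Boppana, *The monotone circuit complexity of Boolean functions*,
  Combinatorica 7 (1987) 1–22, §1, Thm. 2.1, §3.1–3.2, Lemmas 3.6, 3.7, 3.13, 3.14,
  Thm. 3.16 [AlonBoppana1987].
-/

namespace Literature.Computability.Complexity

open Finset GateList Razborov Real Filter

section MonotoneCircuit

variable {ι : Type*} {m : ℕ}

/-! ### Iterated monotone gates -/

/-- The conjunction of a nonempty list of input positions costs at most its length in gates
over the monotone basis `{∧₂, ∨₂}` (a chain of binary ANDs). [folklore] -/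
theorem cktSize_all : ∀ (l : List ι), l ≠ [] →
    CktSize monotoneBasis (fun (x : ι → Bool) (_ : Unit) => l.all fun i => x i) l.length
  | [], h => absurd rfl h
  | [i], _ => ((CktSize.proj monotoneBasis fun _ : Unit => i).of_le (Nat.zero_le _)).congr
      fun x _ => by simp
  | i :: j :: l, _ => by
    have ht := cktSize_all (j :: l) (List.cons_ne_nil j l)
    have h1 := (CktSize.proj monotoneBasis fun _ : Unit => i).pair ht
    have h2 := h1.comp (CktSize.gate (ι := Unit ⊕ Unit) (B := monotoneBasis) (GateFn.and 2)
      and_mem_monotoneBasis ![Sum.inl (), Sum.inr ()])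
    refine (h2.of_le (by simp)).congr fun x _ => ?_
    simp only [GateFn.and, Fin.forall_fin_two, Matrix.cons_val_zero, Matrix.cons_val_one,
      Sum.elim_inl, Sum.elim_inr, Bool.decide_and, Bool.decide_eq_true]
    rfl

/-- The disjunction of a nonempty list of input positions costs at most its length in gates
over the monotone basis `{∧₂, ∨₂}` (a chain of binary ORs). [folklore] -/
theorem cktSize_any : ∀ (l : List ι), l ≠ [] →
    CktSize monotoneBasis (fun (x : ι → Bool) (_ : Unit) => l.any fun i => x i) l.length
  | [], h => absurd rfl h
  | [i], _ => ((CktSize.proj monotoneBasis fun _ : Unit => i).of_le (Nat.zero_le _)).congr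
      fun x _ => by simp
  | i :: j :: l, _ => by
    have ht := cktSize_any (j :: l) (List.cons_ne_nil j l)
    have h1 := (CktSize.proj monotoneBasis fun _ : Unit => i).pair ht
    have h2 := h1.comp (CktSize.gate (ι := Unit ⊕ Unit) (B := monotoneBasis) (GateFn.or 2)
      or_mem_monotoneBasis ![Sum.inl (), Sum.inr ()])
    refine (h2.of_le (by simp)).congr fun x _ => ?_
    simp only [GateFn.or, Fin.exists_fin_two, Matrix.cons_val_zero, Matrix.cons_val_one,
      Sum.elim_inl, Sum.elim_inr, Bool.decide_or, Bool.decide_eq_true]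
    rfl

/-! ### CLIQUE as an OR of ANDs -/

/-- `CLIQUE(m, s)(x) = 1` iff some `s`-set of vertices has all its edges on in `x`. [folklore] -/
theorem cliqueFn_eq_true_iff_exists (s : ℕ) (x : (⊤ : SimpleGraph (Fin m)).edgeSet → Bool) :
    cliqueFn m s x = true ↔ ∃ S : Finset (Fin m), #S = s ∧ ∀ e, IsLive S e → x e = true := by
  rw [cliqueFn_eq_true_iff]
  constructor
  · intro h
    simp only [SimpleGraph.CliqueFree, not_forall, not_not] at h
    obtain ⟨S, hS⟩ := h
    refine ⟨S, hS.card_eq, ?_⟩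
    refine edge_ind fun u v huv => ?_
    intro hlive
    rw [isLive_mk] at hlive
    obtain ⟨hne, hx⟩ := (cliqueGraph_adj x u v).1 (hS.isClique hlive.1 hlive.2 huv)
    exact hx
  · rintro ⟨S, hS, hx⟩ hfree
    have hle : cliqueVec S ≤ x := fun e => by
      rw [Bool.le_iff_imp, cliqueVec_eq_true_iff]
      exact hx e
    have h1 : cliqueFn m s (cliqueVec S) = true := cliqueFn_cliqueVec hS.ge
    have h2 : cliqueFn m s (cliqueVec S) ≤ cliqueFn m s x := cliqueFn_monotone_holds m s hle
    rw [h1, (cliqueFn_eq_false_iff s x).2 hfree] at h2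
    exact absurd h2 (by decide)

/-- **Discharge of `exists_monotone_computes_cliqueFn`** (`CircuitLowerBounds.lean`): for
`2 ≤ s ≤ m` the clique function is computed by a monotone circuit, namely the OR over all
`s`-subsets `S` of the AND of the edges inside `S` (Alon–Boppana 1987, §3; review F13c).
[cite: AlonBoppana1987, §3] -/
theorem exists_monotone_computes_cliqueFn_holds : exists_monotone_computes_cliqueFn := by
  intro m s h2 hsm
  classical
  -- the `s`-subsets and, for each, the list of its edges
  set T : Finset (Finset (Fin m)) := powersetCard s univ with hT
  let E : Finset (Fin m) → List ((⊤ : SimpleGraph (Fin m)).edgeSet) := fun S =>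
    (univ.filter fun e => IsLive S e).toList
  have hEne : ∀ S ∈ T, E S ≠ [] := by
    intro S hS
    have hScard : #S = s := (mem_powersetCard.1 hS).2
    obtain ⟨u, hu, v, hv, huv⟩ := one_lt_card.1 (by omega : 1 < #S)
    have he : s(u, v) ∈ (⊤ : SimpleGraph (Fin m)).edgeSet := (SimpleGraph.mem_edgeSet _).2 huv
    intro hnil
    have : (⟨s(u, v), he⟩ : (⊤ : SimpleGraph (Fin m)).edgeSet) ∈ E S :=
      Finset.mem_toList.2 (mem_filter.2 ⟨mem_univ _, (isLive_mk he).2 ⟨hu, hv⟩⟩)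
    rw [hnil] at this
    simp at this
  have hTne : T.toList ≠ [] := by
    intro hnil
    have hne : T.Nonempty := powersetCard_nonempty.2 (by simpa using hsm)
    obtain ⟨S, hS⟩ := hne
    have := Finset.mem_toList.2 hS
    rw [hnil] at this
    simp at this
  -- stage 1: all the ANDs in parallel
  have h1 : CktSize monotoneBasis
      (fun (x : (⊤ : SimpleGraph (Fin m)).edgeSet → Bool) (S : T) => (E S).all fun e => x e)
      (∑ S : T, (E S).length) :=
    CktSize.pi fun S => cktSize_all (E S) (hEne S S.2)
  -- stage 2: the OR of the results
  have h2 := h1.comp (cktSize_any (ι := T) (univ : Finset T).toList (by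
    intro hnil
    obtain ⟨S, hS⟩ := List.exists_mem_of_ne_nil T.toList hTne
    have := Finset.mem_toList.2 (mem_univ (⟨S, Finset.mem_toList.1 hS⟩ : T))
    rw [hnil] at this
    simp at this))
  obtain ⟨C, hCB, -, hCev⟩ := h2.toCircuit
  refine ⟨C, hCB, fun x => ?_⟩
  rw [hCev]
  -- the OR of ANDs is the clique function
  apply Bool.eq_iff_iff.2
  rw [cliqueFn_eq_true_iff_exists, List.any_eq_true]
  constructor
  · rintro ⟨S, -, hS⟩
    rw [List.all_eq_true] at hS
    refine ⟨S, (mem_powersetCard.1 S.2).2, fun e he => hS e ?_⟩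
    exact Finset.mem_toList.2 (mem_filter.2 ⟨mem_univ _, he⟩)
  · rintro ⟨S, hS, hx⟩
    have hST : S ∈ T := mem_powersetCard.2 ⟨subset_univ _, hS⟩
    refine ⟨⟨S, hST⟩, Finset.mem_toList.2 (mem_univ _), ?_⟩
    rw [List.all_eq_true]
    intro e he
    exact hx e (mem_filter.1 (Finset.mem_toList.1 he)).2

end MonotoneCircuit

/-! ### Elementary exponential inequalities -/

/-- `y² ≤ 2 eʸ` for `y ≥ 0` (from `yⁿ/n! ≤ eʸ`). [folklore] -/
theorem sq_le_two_mul_exp {y : ℝ} (hy : 0 ≤ y) : y ^ 2 ≤ 2 * exp y := by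
  have h := pow_div_factorial_le_exp y hy 2
  have h2 : ((2 : ℕ).factorial : ℝ) = 2 := by norm_num [Nat.factorial]
  rw [h2, div_le_iff₀ (by norm_num)] at h
  linarith

/-- `y³ ≤ 6 eʸ` for `y ≥ 0`. [folklore] -/
theorem pow_three_le_mul_exp {y : ℝ} (hy : 0 ≤ y) : y ^ 3 ≤ 6 * exp y := by
  have h := pow_div_factorial_le_exp y hy 3
  have h3 : ((3 : ℕ).factorial : ℝ) = 6 := by norm_num [Nat.factorial]
  rw [h3, div_le_iff₀ (by norm_num)] at h
  linarith

/-- `y⁴ ≤ 24 eʸ` for `y ≥ 0`. [folklore] -/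
theorem pow_four_le_mul_exp {y : ℝ} (hy : 0 ≤ y) : y ^ 4 ≤ 24 * exp y := by
  have h := pow_div_factorial_le_exp y hy 4
  have h4 : ((4 : ℕ).factorial : ℝ) = 24 := by norm_num [Nat.factorial]
  rw [h4, div_le_iff₀ (by norm_num)] at h
  linarith

/-! ### Binomial ratios -/

/-- `C(m-k, s-k) · m(m-1)⋯(m-k+1) = C(m, s) · s(s-1)⋯(s-k+1)` for `k ≤ s`. [folklore] -/
theorem choose_sub_mul_descFactorial {m s k : ℕ} (hk : k ≤ s) :
    (m - k).choose (s - k) * m.descFactorial k = m.choose s * s.descFactorial k := by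
  have h := Nat.choose_mul (n := m) hk
  rw [Nat.descFactorial_eq_factorial_mul_choose, Nat.descFactorial_eq_factorial_mul_choose]
  calc (m - k).choose (s - k) * (k.factorial * m.choose k)
      = k.factorial * (m.choose k * (m - k).choose (s - k)) := by ring
    _ = k.factorial * (m.choose s * s.choose k) := by rw [h]
    _ = m.choose s * (k.factorial * s.choose k) := by ring

/-- `C(m-k, s-k) ≤ C(m, s) · (s/m)^k` for `k ≤ s ≤ m`, `m > 0`. [folklore] -/
theorem cast_choose_sub_le {m s k : ℕ} (hk : k ≤ s) (hsm : s ≤ m) (hm : 0 < m) :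
    ((m - k).choose (s - k) : ℝ) ≤ m.choose s * ((s : ℝ) / m) ^ k := by
  have hkm : k ≤ m := hk.trans hsm
  have hdpos : (0 : ℝ) < m.descFactorial k := by exact_mod_cast Nat.descFactorial_pos.2 hkm
  have hm' : (0 : ℝ) < m := by exact_mod_cast hm
  have hmk : (0 : ℝ) < (m : ℝ) ^ k := by positivity
  have h1 : ((m - k).choose (s - k) : ℝ) * m.descFactorial k = m.choose s * s.descFactorial k := by
    exact_mod_cast choose_sub_mul_descFactorial hk
  have h2 : (s.descFactorial k : ℝ) * (m : ℝ) ^ k ≤ m.descFactorial k * (s : ℝ) ^ k := by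
    exact_mod_cast descFactorial_mul_pow_le hsm k
  rw [div_pow, ← mul_div_assoc, le_div_iff₀ hmk]
  have h3 : ((m - k).choose (s - k) : ℝ) * (m : ℝ) ^ k * m.descFactorial k ≤
      m.choose s * (s : ℝ) ^ k * m.descFactorial k :=
    calc ((m - k).choose (s - k) : ℝ) * (m : ℝ) ^ k * m.descFactorial k
        = (m.choose s * s.descFactorial k) * (m : ℝ) ^ k := by rw [← h1]; ring
      _ = m.choose s * (s.descFactorial k * (m : ℝ) ^ k) := by ring
      _ ≤ m.choose s * (m.descFactorial k * (s : ℝ) ^ k) :=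
          mul_le_mul_of_nonneg_left h2 (by positivity)
      _ = m.choose s * (s : ℝ) ^ k * m.descFactorial k := by ring
  exact le_of_mul_le_mul_right h3 hdpos

/-- The error sum of Case 1 is at most half of `C(m, s)` once `ρ s / m ≤ 1` and
`s (ρ s / m)² ≤ ½`. [folklore] -/
theorem sum_choose_sub_le_half {m s l : ℕ} {ρ : ℝ} (hρ : 0 ≤ ρ) (hls : l ≤ s) (hsm : s ≤ m)
    (hm : 0 < m) (hx : ρ * s / m ≤ 1) (hx2 : (s : ℝ) * (ρ * s / m) ^ 2 ≤ 1 / 2) :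
    (∑ k ∈ Icc 2 l, ρ ^ k * ((m - k).choose (s - k) : ℝ)) ≤ (m.choose s : ℝ) / 2 := by
  have hx0 : 0 ≤ ρ * s / m := by positivity
  have hterm : ∀ k ∈ Icc 2 l,
      ρ ^ k * ((m - k).choose (s - k) : ℝ) ≤ m.choose s * (ρ * s / m) ^ 2 := by
    intro k hk
    rw [mem_Icc] at hk
    have hks : k ≤ s := hk.2.trans hls
    calc ρ ^ k * ((m - k).choose (s - k) : ℝ) ≤ ρ ^ k * (m.choose s * ((s : ℝ) / m) ^ k) :=
          mul_le_mul_of_nonneg_left (cast_choose_sub_le hks hsm hm) (by positivity)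
      _ = m.choose s * (ρ * s / m) ^ k := by rw [mul_div_assoc, mul_pow]; ring
      _ ≤ m.choose s * (ρ * s / m) ^ 2 :=
          mul_le_mul_of_nonneg_left (pow_le_pow_of_le_one hx0 hx hk.1) (by positivity)
  calc ∑ k ∈ Icc 2 l, ρ ^ k * ((m - k).choose (s - k) : ℝ)
      ≤ ∑ k ∈ Icc 2 l, (m.choose s : ℝ) * (ρ * s / m) ^ 2 := sum_le_sum hterm
    _ = (#(Icc 2 l) : ℝ) * ((m.choose s : ℝ) * (ρ * s / m) ^ 2) := by
          rw [sum_const, nsmul_eq_mul]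
    _ ≤ s * ((m.choose s : ℝ) * (ρ * s / m) ^ 2) := by
          refine mul_le_mul_of_nonneg_right ?_ (by positivity)
          have : #(Icc 2 l) ≤ s := by rw [Nat.card_Icc]; omega
          exact_mod_cast this
    _ = (m.choose s) * ((s : ℝ) * (ρ * s / m) ^ 2) := by ring
    _ ≤ (m.choose s) * (1 / 2) := mul_le_mul_of_nonneg_left hx2 (by positivity)
    _ = (m.choose s : ℝ) / 2 := by ring

/-- `(eᴸ/(2s))ˢ ≤ C(m, s)` when `m = eᴸ`, `1 ≤ s` and `2s ≤ m`. [folklore] -/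
theorem exp_div_pow_le_choose {m s : ℕ} {L : ℝ} (hm : (m : ℝ) = exp L) (hs1 : 1 ≤ s)
    (h2s : 2 * (s : ℝ) ≤ m) : (exp L / (2 * s)) ^ s ≤ (m.choose s : ℝ) := by
  have hspos : (0 : ℝ) < s := by exact_mod_cast hs1
  have hsm : s ≤ m + 1 := by
    have : (s : ℝ) ≤ (m : ℝ) + 1 := by linarith
    exact_mod_cast this
  have h1 : (((m + 1 - s : ℕ) : ℝ) ^ s) / (s.factorial : ℝ) ≤ m.choose s := Nat.pow_le_choose s m
  have hcast : ((m + 1 - s : ℕ) : ℝ) = m + 1 - s := by push_cast [Nat.cast_sub hsm]; ring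
  have hfac : (s.factorial : ℝ) ≤ (s : ℝ) ^ s := by exact_mod_cast Nat.factorial_le_pow s
  have hfpos : (0 : ℝ) < s.factorial := by exact_mod_cast Nat.factorial_pos s
  have hle : exp L / 2 ≤ (m : ℝ) + 1 - s := by rw [← hm]; linarith
  calc (exp L / (2 * s)) ^ s = (exp L / 2) ^ s / (s : ℝ) ^ s := by
        rw [← div_pow, div_div]
    _ ≤ ((m : ℝ) + 1 - s) ^ s / (s : ℝ) ^ s :=
        div_le_div_of_nonneg_right (pow_le_pow_left₀ (by positivity) hle s) (by positivity)
    _ ≤ ((m : ℝ) + 1 - s) ^ s / s.factorial :=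
        div_le_div_of_nonneg_left (pow_nonneg (by linarith [(exp_pos L).le]) s) hfpos hfac
    _ ≤ m.choose s := by rw [← hcast]; exact h1

/-! ### Case 1 (few minimal sets): `t ≥ C(m,s) / (2 ρ^{2l}) ≥ m^{log m / 50}` -/

/-- **Case 1 of the final count** (Alon–Boppana 1987, proof of Lemma 3.14 / Thm. 3.16, crude
constants): with `m = eᴸ`, `L ≥ 1200`, `s = ⌊L/4⌋`, `l = s - 1`, `ρ ≤ e^{L/3}`, the inequality
`C(m,s) ≤ t ρ^{2l} + Σ_{2≤k≤l} ρᵏ C(m-k, s-k)` forces `t ≥ exp(L²/50)`.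
[cite: AlonBoppana1987, Lemma 3.14] -/
theorem caseB_bound {m s l ρ t : ℕ} {L : ℝ} (hL : 1200 ≤ L) (hm : (m : ℝ) = exp L)
    (hsL : (s : ℝ) ≤ L / 4) (hLs : L / 4 < s + 1) (hl : l + 1 = s) (hρ : (ρ : ℝ) ≤ exp (L / 3))
    (h : m.choose s ≤ t * (ρ ^ l) ^ 2 + ∑ k ∈ Icc 2 l, ρ ^ k * (m - k).choose (s - k)) :
    exp (L ^ 2 / 50) ≤ t := by
  have hL0 : 0 ≤ L := by linarith
  have hexpL : 0 < exp L := exp_pos L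
  have hmpos : (0 : ℝ) < m := by rw [hm]; exact hexpL
  have hm0 : 0 < m := by exact_mod_cast hmpos
  have hs3 : (3 : ℝ) ≤ s := by linarith
  have hs1 : 1 ≤ s := by
    have : (1 : ℝ) ≤ s := by linarith
    exact_mod_cast this
  have hls : l ≤ s := by omega
  have hρ0 : (0 : ℝ) ≤ ρ := Nat.cast_nonneg ρ
  -- `L/4 ≤ e^{2L/3}` and `L/2 ≤ e^L`
  have hL4 : L / 4 ≤ exp (2 * L / 3) := by linarith [add_one_le_exp (2 * L / 3)]
  have hL2 : L / 2 ≤ exp L := by linarith [add_one_le_exp L]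
  have hsm' : 2 * (s : ℝ) ≤ m := by rw [hm]; linarith
  have hsm : s ≤ m := by
    have : (s : ℝ) ≤ m := by linarith [hsm', (Nat.cast_nonneg s : (0:ℝ) ≤ s)]
    exact_mod_cast this
  -- the error sum is at most half
  have hx : (ρ : ℝ) * s / m ≤ 1 := by
    rw [div_le_one hmpos, hm]
    calc (ρ : ℝ) * s ≤ exp (L / 3) * (L / 4) := mul_le_mul hρ hsL (Nat.cast_nonneg s) (exp_nonneg _)
      _ ≤ exp (L / 3) * exp (2 * L / 3) := mul_le_mul_of_nonneg_left hL4 (exp_nonneg _)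
      _ = exp L := by rw [← exp_add]; ring_nf
  have hx2 : (s : ℝ) * ((ρ : ℝ) * s / m) ^ 2 ≤ 1 / 2 := by
    have hL3 : L ^ 3 ≤ 32 * exp (4 * L / 3) := by
      have := pow_three_le_mul_exp (y := 4 * L / 3) (by linarith)
      nlinarith [exp_nonneg (4 * L / 3)]
    have hs3' : (s : ℝ) ^ 3 ≤ (1 / 2) * exp (4 * L / 3) := by
      calc (s : ℝ) ^ 3 ≤ (L / 4) ^ 3 := by gcongr
        _ = L ^ 3 / 64 := by ring
        _ ≤ (1 / 2) * exp (4 * L / 3) := by linarith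
    have hρ2 : (ρ : ℝ) ^ 2 ≤ exp (2 * L / 3) := by
      calc (ρ : ℝ) ^ 2 ≤ (exp (L / 3)) ^ 2 := by gcongr
        _ = exp (2 * L / 3) := by rw [sq, ← exp_add]; ring_nf
    have hm2 : (m : ℝ) ^ 2 = exp (4 * L / 3) * exp (2 * L / 3) := by
      rw [hm, sq, ← exp_add, ← exp_add]; ring_nf
    rw [show (s : ℝ) * ((ρ : ℝ) * s / m) ^ 2 = (s : ℝ) ^ 3 * (ρ : ℝ) ^ 2 / (m : ℝ) ^ 2 by
      ring]
    rw [div_le_iff₀ (by positivity), hm2]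
    calc (s : ℝ) ^ 3 * (ρ : ℝ) ^ 2 ≤ ((1 / 2) * exp (4 * L / 3)) * exp (2 * L / 3) :=
          mul_le_mul hs3' hρ2 (by positivity) (by positivity)
      _ = 1 / 2 * (exp (4 * L / 3) * exp (2 * L / 3)) := by ring
  have hsum := sum_choose_sub_le_half hρ0 hls hsm hm0 hx hx2
  -- cast the hypothesis
  have hR : (m.choose s : ℝ) ≤ t * ((ρ : ℝ) ^ l) ^ 2 +
      ∑ k ∈ Icc 2 l, (ρ : ℝ) ^ k * ((m - k).choose (s - k) : ℝ) := by
    exact_mod_cast h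
  have hC : (m.choose s : ℝ) ≤ 2 * t * ((ρ : ℝ) ^ l) ^ 2 := by linarith
  -- `ρ^{2l} ≤ e^{2sL/3}`
  have hρl : ((ρ : ℝ) ^ l) ^ 2 ≤ exp (2 * s * L / 3) := by
    have h1 : (ρ : ℝ) ^ l ≤ exp (L / 3) ^ l := pow_le_pow_left₀ hρ0 hρ l
    have h2 : exp (L / 3) ^ l ≤ exp (L / 3) ^ s :=
      pow_le_pow_right₀ (one_le_exp (by linarith)) hls
    calc ((ρ : ℝ) ^ l) ^ 2 ≤ (exp (L / 3) ^ s) ^ 2 := by gcongr; exact h1.trans h2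
      _ = exp (2 * s * L / 3) := by rw [← exp_nat_mul, sq, ← exp_add]; ring_nf
  -- `C(m,s) ≥ e^{11 s L / 12}`
  have h2s : 2 * (s : ℝ) ≤ exp (L / 12) := by
    have := sq_le_two_mul_exp (y := L / 12) (by linarith)
    nlinarith
  have hchoose : exp (11 * s * L / 12) ≤ (m.choose s : ℝ) := by
    have hspos : (0 : ℝ) < 2 * s := by linarith
    calc exp (11 * s * L / 12) = (exp L / exp (L / 12)) ^ s := by
          rw [← exp_sub, ← exp_nat_mul]; ring_nf
      _ ≤ (exp L / (2 * s)) ^ s := by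
          gcongr
      _ ≤ m.choose s := exp_div_pow_le_choose hm hs1 hsm'
  -- combine
  have hfin : exp (11 * s * L / 12) ≤ 2 * t * exp (2 * s * L / 3) :=
    hchoose.trans (hC.trans (mul_le_mul_of_nonneg_left hρl (by positivity)))
  have ht0 : (0 : ℝ) ≤ t := Nat.cast_nonneg t
  have hkey : exp (s * L / 4) ≤ 2 * t := by
    have heq : exp (11 * s * L / 12) = exp (s * L / 4) * exp (2 * s * L / 3) := by
      rw [← exp_add]; ring_nf
    rw [heq] at hfin
    exact le_of_mul_le_mul_right (by linarith) (exp_pos (2 * s * L / 3))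
  have h2e : (2 : ℝ) ≤ exp 1 := by linarith [add_one_le_exp (1 : ℝ)]
  have hkey' : exp (s * L / 4 - 1) ≤ t := by
    rw [exp_sub, div_le_iff₀ (exp_pos 1)]
    calc exp (s * L / 4) ≤ 2 * t := hkey
      _ ≤ t * exp 1 := by nlinarith
  refine le_trans (exp_le_exp.2 ?_) hkey'
  have hsL' : L / 4 - 1 ≤ s := by linarith
  nlinarith

/-! ### Case 2 (the approximator is `≡ 1`): `t ≥ e^{r e^{-l}} / (m+1)^l ≥ m^{log m / 50}` -/

/-- **Case 2 of the final count** (Alon–Boppana 1987, proof of Lemma 3.14, Case 2, crude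
constants): with `m = eᴸ`, `L ≥ 1200`, `2 ≤ l ≤ s ≤ L/4`, `r ≥ e^{L/3}`, `N ≤ (m+1)^l`, the
inequality `l^m (l^l)^r ≤ t · N · (l^l - l!)^r · l^m` forces `t ≥ exp(L²/50)`.
[cite: AlonBoppana1987, Lemma 3.14] -/
theorem caseA_bound {m s l r N t : ℕ} {L : ℝ} (hL : 1200 ≤ L) (hm : (m : ℝ) = exp L)
    (hsL : (s : ℝ) ≤ L / 4) (hls : l ≤ s) (hl : 2 ≤ l) (hr : exp (L / 3) ≤ r)
    (hN : (N : ℝ) ≤ ((m : ℝ) + 1) ^ l)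
    (h : l ^ m * (l ^ l) ^ r ≤ t * (N * ((l ^ l - l.descFactorial l) ^ r * l ^ m))) :
    exp (L ^ 2 / 50) ≤ t := by
  have hL0 : 0 ≤ L := by linarith
  have hfact : l.descFactorial l = l.factorial := Nat.descFactorial_self l
  have hdle : l.factorial ≤ l ^ l := Nat.factorial_le_pow l
  have hlpos : (0 : ℝ) < l := by exact_mod_cast (show 0 < l by omega)
  have hd : (0 : ℝ) < l.factorial := by exact_mod_cast Nat.factorial_pos l
  have hda : (l.factorial : ℝ) ≤ (l : ℝ) ^ l := by exact_mod_cast hdle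
  have h3ad : (l : ℝ) ^ l / l.factorial ≤ exp l := pow_div_factorial_le_exp (l : ℝ) hlpos.le l
  set a : ℝ := (l : ℝ) ^ l with ha_def
  set d : ℝ := (l.factorial : ℝ) with hd_def
  have ha : 0 < a := by positivity
  have hR : (l : ℝ) ^ m * a ^ r ≤ t * (N * ((a - d) ^ r * (l : ℝ) ^ m)) := by
    rw [hfact] at h
    have := (Nat.cast_le (α := ℝ)).2 h
    push_cast [Nat.cast_sub hdle] at this
    exact this
  have hlm : 0 < (l : ℝ) ^ m := by positivity
  -- cancel `l^m`
  have h1 : a ^ r ≤ t * N * (a - d) ^ r := by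
    rw [show (t : ℝ) * (N * ((a - d) ^ r * (l : ℝ) ^ m)) = (t * N * (a - d) ^ r) * (l : ℝ) ^ m by
      ring, mul_comm] at hR
    exact le_of_mul_le_mul_right hR hlm
  -- `(a - d)^r ≤ a^r exp(-r e^{-l})`
  have hβ : (a - d) ^ r ≤ a ^ r * exp (-(r * exp (-(l : ℝ)))) := by
    have hq : a - d = a * (1 - d / a) := by field_simp
    rw [hq, mul_pow]
    refine mul_le_mul_of_nonneg_left ?_ (by positivity)
    have h01 : 0 ≤ 1 - d / a := by rw [sub_nonneg, div_le_one ha]; exact hda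
    have hexp : 1 - d / a ≤ exp (-exp (-(l : ℝ))) := by
      refine (one_sub_le_exp_neg _).trans (exp_le_exp.2 (neg_le_neg ?_))
      have h3 : a / d ≤ exp l := h3ad
      have h4 : (exp (l : ℝ))⁻¹ ≤ (a / d)⁻¹ := inv_anti₀ (by positivity) h3
      rwa [← exp_neg, inv_div] at h4
    calc (1 - d / a) ^ r ≤ (exp (-exp (-(l : ℝ)))) ^ r := pow_le_pow_left₀ h01 hexp r
      _ = exp (-(r * exp (-(l : ℝ)))) := by rw [← exp_nat_mul]; ring_nf
  -- so `exp(r e^{-l}) ≤ t N`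
  have h2 : a ^ r ≤ (t * N * exp (-(r * exp (-(l : ℝ))))) * a ^ r := by
    calc a ^ r ≤ t * N * (a - d) ^ r := h1
      _ ≤ t * N * (a ^ r * exp (-(r * exp (-(l : ℝ))))) :=
          mul_le_mul_of_nonneg_left hβ (by positivity)
      _ = (t * N * exp (-(r * exp (-(l : ℝ))))) * a ^ r := by ring
  have h3 : 1 ≤ t * N * exp (-(r * exp (-(l : ℝ)))) :=
    le_of_mul_le_mul_right (b := 1) (a := a ^ r) (by rw [one_mul]; exact h2) (pow_pos ha r)
  have h4 : exp (r * exp (-(l : ℝ))) ≤ t * N := by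
    rw [exp_neg] at h3
    have hE := exp_pos (r * exp (-(l : ℝ)))
    have := mul_le_mul_of_nonneg_right h3 hE.le
    rwa [one_mul, mul_assoc, inv_mul_cancel₀ hE.ne', mul_one] at this
  -- lower bound `r e^{-l} ≥ e^{L/12}`
  have hrl : exp (L / 12) ≤ r * exp (-(l : ℝ)) := by
    have hls' : (l : ℝ) ≤ L / 4 := le_trans (by exact_mod_cast hls) hsL
    calc exp (L / 12) = exp (L / 3) * exp (-(L / 4)) := by rw [← exp_add]; ring_nf
      _ ≤ r * exp (-(l : ℝ)) :=
          mul_le_mul hr (exp_le_exp.2 (by linarith)) (exp_nonneg _) (Nat.cast_nonneg r)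
  -- upper bound `N ≤ exp((L+1) L/4)`
  have hN' : (N : ℝ) ≤ exp ((L + 1) * L / 4) := by
    have hm1 : (m : ℝ) + 1 ≤ exp (L + 1) := by
      rw [exp_add, hm]
      have h2e : (2 : ℝ) ≤ exp 1 := by linarith [add_one_le_exp (1 : ℝ)]
      have h1e : (1 : ℝ) ≤ exp L := one_le_exp hL0
      nlinarith
    calc (N : ℝ) ≤ ((m : ℝ) + 1) ^ l := hN
      _ ≤ (exp (L + 1)) ^ l := pow_le_pow_left₀ (by positivity) hm1 l
      _ ≤ (exp (L + 1)) ^ s := pow_le_pow_right₀ (one_le_exp (by linarith)) hls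
      _ = exp (s * (L + 1)) := by rw [← exp_nat_mul]
      _ ≤ exp ((L + 1) * L / 4) := exp_le_exp.2 (by nlinarith)
  -- combine: `exp(e^{L/12}) ≤ t exp((L+1)L/4)`
  have ht0 : (0 : ℝ) ≤ t := Nat.cast_nonneg t
  have h5 : exp (exp (L / 12)) ≤ t * exp ((L + 1) * L / 4) :=
    calc exp (exp (L / 12)) ≤ exp (r * exp (-(l : ℝ))) := exp_le_exp.2 hrl
      _ ≤ t * N := h4
      _ ≤ t * exp ((L + 1) * L / 4) := mul_le_mul_of_nonneg_left hN' ht0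
  have h6 : exp (exp (L / 12) - (L + 1) * L / 4) ≤ t := by
    rw [exp_sub, div_le_iff₀ (exp_pos _)]
    exact h5
  refine le_trans (exp_le_exp.2 ?_) h6
  -- `L²/50 ≤ e^{L/12} - (L+1)L/4` for `L ≥ 1200`
  have h7 : (L / 12) ^ 4 ≤ 24 * exp (L / 12) := pow_four_le_mul_exp (by linarith)
  have hL2 : L * L ≥ 1200 * L := by nlinarith
  nlinarith [h7, hL2]

/-! ### The lower bound -/

/-- **Discharge of `razborov_alon_boppana`** (pnp.S22). Monotone circuits for
`CLIQUE(m, ⌊¼ ln m⌋)` have at least `m ^ (log m / 50)` gates for all large `m`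
(Razborov 1985; Alon–Boppana 1987, §1 (the display after (1.1)) and Thm. 3.16 — the printed
constants are sharper: `m^s / (8 s² eˢ log₂ m)ˢ` AND gates for `3 ≤ s ≤ ¼ log₂ m`). Proof:
Razborov's approximation method in the lattice `K(m, r, l)` with `l = s - 1`,
`(s-1)`-colourings and `r = ⌈m^{1/3}⌉` (`razborov_dichotomy`), followed by the counting
estimates `caseA_bound` (Case 2 of Lemma 3.14) and `caseB_bound` (Case 1 of Lemma 3.14).
[cite: AlonBoppana1987, Thm. 3.16] -/
theorem razborov_alon_boppana_holds : razborov_alon_boppana := by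
  refine ⟨1 / 50, by norm_num, ?_⟩
  rw [eventually_atTop]
  refine ⟨⌈exp 1200⌉₊, fun m hm => ?_⟩
  -- the parameters
  have hm1200 : exp 1200 ≤ (m : ℝ) := (Nat.le_ceil _).trans (by exact_mod_cast hm)
  have hmpos : (0 : ℝ) < m := (exp_pos _).trans_le hm1200
  set L : ℝ := Real.log m with hL_def
  have hmL : (m : ℝ) = exp L := (exp_log hmpos).symm
  have hL : 1200 ≤ L := by rwa [hL_def, le_log_iff_exp_le hmpos]
  have hL0 : 0 ≤ L := by linarith
  set s : ℕ := ⌊L / 4⌋₊ with hs_def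
  have hsL : (s : ℝ) ≤ L / 4 := Nat.floor_le (by linarith)
  have hLs : L / 4 < s + 1 := Nat.lt_floor_add_one _
  have hs3 : 3 ≤ s := Nat.le_floor (by push_cast; linarith)
  have hsm : s ≤ m := by
    have : (s : ℝ) ≤ m := by rw [hmL]; linarith [add_one_le_exp L]
    exact_mod_cast this
  set r : ℕ := ⌈exp (L / 3)⌉₊ with hr_def
  have hr : exp (L / 3) ≤ r := Nat.le_ceil _
  have hr2 : 2 ≤ r := by
    have : (2 : ℝ) ≤ r := le_trans (by linarith [add_one_le_exp (L / 3)]) hr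
    exact_mod_cast this
  have hρ : ((r - 1 : ℕ) : ℝ) ≤ exp (L / 3) := by
    have h1 : ((r - 1 : ℕ) : ℝ) = r - 1 := by push_cast [Nat.cast_sub (by omega : 1 ≤ r)]; ring
    rw [h1]
    linarith [Nat.ceil_lt_add_one (exp_nonneg (L / 3))]
  -- a smallest monotone circuit for CLIQUE(m, s)
  obtain ⟨C, hCB, hCf, hsize⟩ := exists_circuit_size_eq_circuitSizeOver
    (exists_monotone_computes_cliqueFn_holds (by omega) hsm)
  rw [← hsize]
  have hrpow : (m : ℝ) ^ ((1 : ℝ) / 50 * L) = exp (L ^ 2 / 50) := by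
    rw [rpow_def_of_pos hmpos, ← hL_def]; ring_nf
  rw [hrpow]
  -- Razborov's dichotomy with `l = g = s - 1`
  have hpos : ∀ Z : Finset (Fin m), #Z = s → cliqueFn m s (cliqueVec Z) = true :=
    fun Z hZ => cliqueFn_cliqueVec hZ.ge
  have hneg : ∀ O : Fin m → Fin (s - 1), cliqueFn m s (colorVec O) = false :=
    fun O => cliqueFn_colorVec O (by omega)
  rcases razborov_dichotomy (r := r) (l := s - 1) (s := s) (g := s - 1) hr2 (by omega) (by omega)
      C hCB hCf hpos hneg with hA | hB
  · -- Case 2: the approximator accepts everything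
    refine caseA_bound (s := s) (l := s - 1) hL hmL hsL (Nat.sub_le s 1) (by omega) hr ?_ hA
    have h := card_smallSets_le (α := Fin m) (s - 1)
    rw [Fintype.card_fin] at h
    exact_mod_cast h
  · -- Case 1: few minimal sets
    exact caseB_bound (l := s - 1) (ρ := r - 1) hL hmL hsL hLs (by omega) hρ hB

end Literature.Computability.Complexity
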